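import Summits.FinalStateConjecture.FinalStateConjecture.Theorems.RenormalisedDriftDriftCaptureCensorNNecessity
import HarnessLib
import HarnessLib.Audit

/-!
# Crux `DriftCapture` (stmt-FinalStateConjecture-17391, route RenormalisedDrift) · line `registered` · stub CENSOR-N
# `stub_noHiddenCompleteRays` — negative lemma: a HIDDEN-RAY development refutes N
# (modulo the construction target `HiddenRayDevelopment`)

The v9/v10 skeleton of the crux (`Cruxes/DriftCapture/Lines/birth.lean`) reduces `DriftCapture` to
ENGINE → FLAT → GLUE → CENSOR, and CENSOR = S ∧ N ⇒ summit clause (C) `RaysStayInClosure` (every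
future-complete normalised null ray from `Σ` stays in the closure of the settled exterior). Its registered stub
CENSOR-N `stub_noHiddenCompleteRays` is, VERBATIM, stub N of the shared item stmt-FinalStateConjecture-17673
`SettledExteriorHoldsRays`: for every censored MGHD `𝒟` of admissible data admitting an honest exhaustive
future-oriented sub-extremal `2`-decomposition, `EndVisible.CompleteRaysNearEndVisible 𝒟` — no future-complete
normalised null ray from `Σ` is hidden from the asymptotically flat end. N is pure causal topology and
OPERATOR-CONTINGENT (question Q-F1 on clause (C)): it is what clause (C) makes load-bearing
(`RenormalisedDriftDriftCaptureCensorNNecessity`: on a development with a hidden complete ray NO witness region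
inside `closure (endVisibleRegion 𝒟)` satisfies (C)), and it is believed FALSE exactly on developments carrying a
hidden expanding vacuum pocket behind a neck (refuter hypothesis H2; recorded in prose by the earlier leads of this line,
`Cruxes/DriftCapture/Lines/birth-lead-c2.md`–`birth-lead-c4.md`, and in the docstring of the stub in the skeleton).

This file puts the precise negative edge in the tree, kernel-checked:

* `HiddenRayDevelopment` — the `H` of the lemma, a CONSTRUCTION TARGET, NOT a theorem of the tree: some admissible
  datum has a maximal vacuum Cauchy development with complete `𝓘⁺` which settles honestly in the end (the four
  hypotheses of N verbatim: sub-extremal, `O = exteriorOf 𝒟 fd.charted`, exhaustive, future-oriented) AND carries a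
  hidden future-complete ray in PRIMITIVE causal form — a compact `K₀ ⊆ X` and an OPEN `P ⊆ M` such that no
  future-complete normalised null ray launched from a data point outside `K₀` has a nonnegative-parameter point
  in `I⁺(P)`, while some future-complete normalised null ray from `Σ` has a nonnegative-parameter point in `P`.
  Intended witness: an asymptotically flat Schwarzschild-like end joined through an Einstein–Rosen neck to an
  expanding closed-hyperbolic vacuum pocket with future-complete interior null rays (`X = ℝ³ # ℍ³/Γ`, one end;
  H2 of `Cruxes/PocketExists/STRATEGY-CENSUS.md`, unprinted in vacuum — matter prototype: Burnett, Phys. Rev.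
  D 52 (1995) 6856 = gr-qc/9504012, pp. 3–4 (passive topological censorship fails for `K(π,1)` factors); why the
  global future of the punctured pocket is open: Hintz, arXiv:2408.06715, p. 4). On that witness `H` is honest:
  far-launched complete rays escape to `𝓘⁺` inside the domain of outer communications of the end and never enter
  the black-hole region `⊇ I⁺(P)`, and nothing from the pocket exits through the pinching neck. (The stronger
  separation `Disjoint (I⁺ P) (J⁺(ι '' K₀ᶜ))` of an earlier seat is deliberately NOT used: on the witness the
  futures of the pocket and of the far data MEET inside the black hole, so that form is unsatisfiable for a junk
  reason.)
* `stub_noHiddenCompleteRays_false_of_hiddenRayDevelopment : HiddenRayDevelopment → ¬ N`, with the registered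
  signature of N negated verbatim: N makes the hidden ray's point `γ t ∈ P` adhere to `endVisibleRegion 𝒟`; the
  open `P` then contains an end-visible event `q`; end-visibility of `q` beyond `K₀` produces a far-launched
  complete ray `δ` and a point `δ u`, `u ≥ 0`, with `q ≪ δ u`, i.e. `δ u ∈ I⁺(P)` — contradiction.
* `not_hiddenRayDevelopment_of_stub_noHiddenCompleteRays` — the contrapositive: whoever proves N refutes `H`;
  whoever constructs `H` kills stub N (and with it line `registered` of stmt-17391 and stub N of stmt-17673).

Scope. The lemma does NOT refute `DriftCapture` itself (nor item 17673's parent conjecture as a whole): the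
conclusion of `DriftCapture` is existential in the decomposition, and a decomposition's flat chart domain
`flatDomain : Opens E4` is lower-bounded only, so on pocketed data a typed witness with tendrils of `d.charted`
reaching the pocket may still satisfy (C) (cf. `Theorems/ChannelsResolveTameDevelopmentsR/Negative/
ChannelsResolveTameDevelopmentsRFalseOfTamePocket.lean`, §Status, and the `flatDomain` lower-bound-only finding
recorded there); moreover the all-accuracy tracking hypothesis of `DriftCapture` is itself in question on such
data. What `H` refutes is the LINE's witness-free stub N on such data — the reduction, not the crux.

No cited facts are used; no new structures; nothing here restates a route item. References: Hawking–Ellis 1973,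
§6.8 (past sets), §9.2 (`J⁻(𝓘⁺)`, black-hole region); O'Neill 1983, Ch. 14, pp. 402–403 (time duality);
Dafermos–Luk arXiv:1710.01722, Conjecture 1 and p. 10 (no interior claim); Burnett gr-qc/9504012 pp. 3–4;
Hintz arXiv:2408.06715 p. 4.
-/

set_option linter.dupNamespace false

noncomputable section

namespace Summit.FinalStateConjecture.FinalStateConjecture.Theorems.DriftCapture.Negative

open Set Filter Topology
open scoped Manifold ContDiff
open Literature.Geometry.Lorentzian

/-- **Construction target `HiddenRayDevelopment` (the `H` of the negative lemma below; a CONSTRUCTION TARGET,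
not a theorem of the tree).** There are a one-ended data carrier `X`, an admissible vacuum datum `D` on it and a
MAXIMAL vacuum Cauchy development `𝒟` of `D` such that (1) `𝒟` has complete null infinity in the sojourn sense
(`Summit.FinalStateConjecture.HasCompleteNullInfinity`); (2) `𝒟` settles honestly in the end — it admits a
sub-extremal `2`-decomposition `fd` of a region `O` with `O = exteriorOf 𝒟 fd.charted`, `HasExhaustiveCharts fd`
and `IsFutureOriented fd` (the four hypotheses of stub N, verbatim); and (3) `𝒟` carries a HIDDEN
future-complete ray, in primitive causal form and for the Levi-Civita connection of `g` granted its existence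
(bound `∀ [HasLeviCivita]` exactly as in `EndVisible.CompleteRaysNearEndVisible`; the class is a PROVABLE `Prop`,
`PseudoRiemannianMetric.hasLeviCivita`, so the binder neither weakens nor strengthens the clause): there are a compact `K₀ ⊆ X` and an OPEN set `P ⊆ M` such that (3a) for
every data point `p ∉ K₀` and every future-complete normalised null ray `δ` from `p` (affine domain `s`
unbounded above) the nonnegative half `δ '' (s ∩ [0, ∞))` is disjoint from the chronological future `I⁺(P)`,
and (3b) some future-complete normalised null ray `γ` from some data point has a point `γ t`, `t ∈ dom`,
`t ≥ 0`, in `P`. Intended witness (refuter hypothesis H2, unprinted in vacuum): an asymptotically flat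
Schwarzschild-like end joined through an Einstein–Rosen neck to an expanding closed-hyperbolic vacuum pocket
with future-complete interior null rays; `K₀` = pocket ∪ neck ∪ a large ball of the end, `P` = an open piece of
the pocket's future development (inside the black-hole region of the end): far-launched complete rays escape to
`𝓘⁺` and never meet `I⁺(P)`, nothing from the pocket exits through the neck. Matter prototype: Burnett,
Phys. Rev. D 52 (1995) 6856 (gr-qc/9504012), pp. 3–4; openness of the punctured pocket's global future: Hintz,
arXiv:2408.06715, p. 4. If `H` is refuted the lemma below is vacuous and places no hold on anything. [folklore] -/
@[conjecture] def HiddenRayDevelopment : Prop :=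
  ∃ (X : Type) (_ : TopologicalSpace X) (_ : ChartedSpace Literature.Geometry.Lorentzian.E3 X) (_ : IsManifold (modelWithCornersSelf ℝ Literature.Geometry.Lorentzian.E3) ((⊤ : ℕ∞) : WithTop ℕ∞) X) (_ : T2Space X) (_ : SecondCountableTopology X) (_ : ConnectedSpace X) (D : Literature.Geometry.Lorentzian.InitialDataSet (modelWithCornersSelf ℝ Literature.Geometry.Lorentzian.E3) X) (_ : D ∈ Literature.Geometry.Lorentzian.admissibleVacuumData X) (𝒟 : Literature.Geometry.Lorentzian.VacuumCauchyDevelopment D), 𝒟.IsMaximal ∧ _root_.Summit.FinalStateConjecture.HasCompleteNullInfinity 𝒟.toCauchyDevelopment ∧ (∃ (O : Set 𝒟.carrier) (fd : Literature.Geometry.Lorentzian.FinalStateDecomposition 𝒟.toSpacetime O 2), (∀ i, Literature.Geometry.Lorentzian.Kerr.IsSubextremal (fd.mass i) (fd.spin i)) ∧ O = _root_.Summit.FinalStateConjecture.exteriorOf 𝒟.toCauchyDevelopment fd.charted ∧ _root_.Summit.FinalStateConjecture.HasExhaustiveCharts fd ∧ _root_.Summit.FinalStateConjecture.IsFutureOriented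 fd) ∧ ∀ [𝒟.metric.HasLeviCivita], ∃ K₀ : Set X, IsCompact K₀ ∧ ∃ P : Set 𝒟.carrier, IsOpen P ∧ (∀ p ∉ K₀, ∀ (δ : ℝ → 𝒟.carrier) (s : Set ℝ), 𝒟.metric.IsNormalisedNullRayFrom 𝒟.timeOrientation 𝒟.embed 𝒟.normal p δ s → ¬ BddAbove s → Disjoint (δ '' (s ∩ Set.Ici 0)) (𝒟.metric.chronologicalFuture 𝒟.timeOrientation P)) ∧ ∃ (p : X) (γ : ℝ → 𝒟.carrier) (dom : Set ℝ), 𝒟.metric.IsNormalisedNullRayFrom 𝒟.timeOrientation 𝒟.embed 𝒟.normal p γ dom ∧ ¬ BddAbove dom ∧ ∃ t ∈ dom, 0 ≤ t ∧ γ t ∈ P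

/-- **Negative lemma for CENSOR-N (stub `stub_noHiddenCompleteRays` of crux stmt-FinalStateConjecture-17391, = stub N
of stmt-FinalStateConjecture-17673 verbatim): a hidden-ray development refutes N.** The registered signature of N is
negated VERBATIM (header on one line). Proof: unpack `H`; N at `(X, D, 𝒟, O, fd)` gives
`EndVisible.CompleteRaysNearEndVisible 𝒟`, so the hidden ray's point `γ t ∈ P` lies in
`closure (endVisibleRegion 𝒟)`; `P` being open, some `q ∈ P` is end-visible (`mem_closure_iff`); end-visibility of
`q` with `K := K₀` (`EndVisible.IsEndVisibleEvent`) yields `p' ∉ K₀` and a future-complete normalised null ray `δ`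
from `p'` with `q ∈ I⁻(δ '' (s ∩ [0, ∞)))`, i.e. (time duality, `LorentzianMetric.mem_chronologicalPast_iff_exists`)
a point `x = δ u`, `u ≥ 0`, with `q ≪ x`; since `q ∈ P`, `x ∈ I⁺(P)` (`LorentzianMetric.mem_chronologicalFuture_of_mem`),
contradicting the disjointness (3a) for the far ray `δ`. This refutes the LINE's stub N on hidden-ray data, not
`DriftCapture` itself (module docstring, §Scope). [cite: HawkingEllis1973, §9.2] -/
theorem stub_noHiddenCompleteRays_false_of_hiddenRayDevelopment : HiddenRayDevelopment → ¬ (open Literature.Geometry.Lorentzian Summit.FinalStateConjecture.FinalStateConjecture.Theorems in open scoped Manifold ContDiff in ∀ (X : Type) [TopologicalSpace X] [ChartedSpace E3 X] [IsManifold (𝓡 3) ∞ X] [T2Space X] [SecondCountableTopology X] [ConnectedSpace X] (D : InitialDataSet (𝓡 3) X), D ∈ admissibleVacuumData X → ∀ 𝒟 : VacuumCauchyDevelopment D, 𝒟.IsMaximal → Summit.FinalStateConjecture.HasCompleteNullInfinity 𝒟.toCauchyDevelopment → ∀ (O : Set 𝒟.carrier) (fd : FinalStateDecomposition 𝒟.toSpacetime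 O 2), (∀ i, Kerr.IsSubextremal (fd.mass i) (fd.spin i)) → O = Summit.FinalStateConjecture.exteriorOf 𝒟.toCauchyDevelopment fd.charted → Summit.FinalStateConjecture.HasExhaustiveCharts fd → Summit.FinalStateConjecture.IsFutureOriented fd → EndVisible.CompleteRaysNearEndVisible 𝒟.toCauchyDevelopment) := by
  rintro ⟨X, _, _, _, _, _, _, D, hD, 𝒟, hmax, hscri, ⟨O, fd, hsub, hO, hexh, hfo⟩, hhid⟩ hN
  -- N at `(X, D, 𝒟, O, fd)`: no future-complete normalised null ray from `Σ` is hidden from the end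
  have hN' : EndVisible.CompleteRaysNearEndVisible 𝒟.toCauchyDevelopment :=
    hN X D hD 𝒟 hmax hscri O fd hsub hO hexh hfo
  -- the Levi-Civita connection of `g` exists outright; every causal notion below refers to it
  haveI : 𝒟.metric.HasLeviCivita := PseudoRiemannianMetric.hasLeviCivita _
  obtain ⟨K₀, hK₀, P, hP, hfar, p, γ, dom, hγ, hdom, t, ht, ht0, hγt⟩ := hhid
  -- the hidden ray's point `γ t ∈ P` adheres to the end-visible region, so the open `P` meets it
  have hcl : γ t ∈ closure (EndVisible.endVisibleRegion 𝒟.toCauchyDevelopment) :=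
    hN' p γ dom hγ hdom t ht ht0
  obtain ⟨q, hqP, hq⟩ := mem_closure_iff.1 hcl P hP hγt
  -- end-visibility of `q` beyond `K₀`: a far-launched complete ray `δ` with `q ∈ I⁻(δ '' (s ∩ [0, ∞)))`
  obtain ⟨p', hp', δ, s, hδ, hs, hqs⟩ := hq K₀ hK₀
  -- time duality: some `x = δ u`, `u ≥ 0`, with `q ≪ x`
  obtain ⟨x, hx, hqx⟩ :=
    (LorentzianMetric.mem_chronologicalPast_iff_exists (g := 𝒟.metric) (τ := 𝒟.timeOrientation)).1 hqs
  -- `q ∈ P` and `q ≪ x` give `x ∈ I⁺(P)`, against (3a) for the far ray `δ`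
  exact Set.disjoint_left.1 (hfar p' hp' δ s hδ hs) hx
    (LorentzianMetric.mem_chronologicalFuture_of_mem hqP hqx)

/-- **Contrapositive: N as registered is also a censorship statement on black-hole INTERIORS.** If
`stub_noHiddenCompleteRays` holds (its registered signature, verbatim) then NO admissible datum has a maximal
vacuum Cauchy development with complete `𝓘⁺` that settles honestly in the end and carries a hidden future-complete
ray in the sense of `HiddenRayDevelopment` — a claim about regions the asymptotically flat end cannot see, on which
Dafermos–Luk's Conjecture 1 is silent (arXiv:1710.01722, p. 10). Graph reading: a negative edge on the construction
target `H` under the registered stub N — whoever proves N refutes `H`, whoever constructs `H` kills N. (Audit class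
`refutes.conditional`: the hypothesis is the registered stub N by SIGNATURE — registered stubs are theorems of the crux
workfile, not nameable `Prop` constants of the tree — so the edge is recorded, not credited; nothing is settled by it.)
Immediate from `stub_noHiddenCompleteRays_false_of_hiddenRayDevelopment`. [folklore] -/
theorem not_hiddenRayDevelopment_of_stub_noHiddenCompleteRays : (open Literature.Geometry.Lorentzian Summit.FinalStateConjecture.FinalStateConjecture.Theorems in open scoped Manifold ContDiff in ∀ (X : Type) [TopologicalSpace X] [ChartedSpace E3 X] [IsManifold (𝓡 3) ∞ X] [T2Space X] [SecondCountableTopology X] [ConnectedSpace X] (D : InitialDataSet (𝓡 3) X), D ∈ admissibleVacuumData X → ∀ 𝒟 : VacuumCauchyDevelopment D, 𝒟.IsMaximal → Summit.FinalStateConjecture.HasCompleteNullInfinity 𝒟.toCauchyDevelopment → ∀ (O : Set 𝒟.carrier) (fd : FinalStateDecomposition 𝒟.toSpacetime O 2), (∀ i, Kerr.IsSubextremal (fd.mass i) (fd.spin i)) → O = Summit.FinalStateConjecture.exteriorOf 𝒟.toCauchyDevelopment fd.charted → Summit.FinalStateConjecture.HasExhaustiveCharts fd → Summit.FinalStateConjecture.IsFutureOriented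 fd → EndVisible.CompleteRaysNearEndVisible 𝒟.toCauchyDevelopment) → ¬ HiddenRayDevelopment :=
  fun hN h ↦ stub_noHiddenCompleteRays_false_of_hiddenRayDevelopment h hN

end Summit.FinalStateConjecture.FinalStateConjecture.Theorems.DriftCapture.Negative

end
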